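import Summits.RiemannHypothesis.RiemannHypothesis.Theorems.PfPersistenceConeTailBound
import Literature.NumberTheory.LFunctions.WeilTwoPrimePos59
import HarnessLib

/-!
# PF persistence, fake seat 4 — THEOREM F4-B± below `59/100`: the UNCONDITIONAL cone tail bounds

Unit `pub-rhpf-fake-4` (gen 2) of the `pub-rhpf` cell — mechanism / rigidity campaign; **no RH claims**.

`PfPersistenceConeTailBound.downCone_twin_le` / `upCone_twin_le` take `WeilPositivityOn (log n₀/2 + b)`
as a hypothesis.  On windows `log n₀/2 + b ≤ 59/100` that hypothesis is a THEOREM of the tree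
(`weilPositivityOn_59_100`, RH-free), so there the cone tail bounds hold outright: the only input left
is the Rayleigh number `ε` of the chosen one-signed bump `g₁` on `[-b, b]` (a certified computation,
DATA in FAKES.md §4.5).  The live case is `n₀ = 2` (`log 2/2 = 0.3466`, `b ≤ 0.2434`): every real table
in the down-cone that agrees with `ζ` below `2b` and drops by `δ` at `2` — in particular EVERY `±1`
sign twist with `f(2) = -1` — and every up-cone table exceeding `ζ` by `δ` at `2`, is NEGATIVE at the
window `log 2/2 + b` in an explicit twin direction as soon as `2ε < δ`; the up-cone direction is
one-signed.  References: A. Weil 1952; E. Bombieri, Rend. Mat. Acc. Lincei (9) 11 (2000) §4.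
-/

set_option linter.dupNamespace false  -- the mandated namespace repeats `RiemannHypothesis`

noncomputable section

open Set MeasureTheory Complex Literature.NumberTheory.LFunctions
open Summit.RiemannHypothesis.RiemannHypothesis.Theorems.PfPersistenceDownCone
open Summit.RiemannHypothesis.RiemannHypothesis.Theorems.PfPersistenceF5TailTwins (twin)
open Summit.RiemannHypothesis.RiemannHypothesis.Theorems.PfPersistenceConeTailBound
open Summit.RiemannHypothesis.RiemannHypothesis.Theorems.PfPersistenceBarrier
open Summit.RiemannHypothesis.RiemannHypothesis.Theorems.PfPersistenceBarrier.ExplicitDatum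

namespace Summit.RiemannHypothesis.RiemannHypothesis.Theorems.PfPersistenceConeTailBound59

/-- `Q_ζ ≥ 0` on every window `A ≤ 59/100` (restriction of the tree's `weilPositivityOn_59_100`).
[cite: Bombieri2000Weil, §4] -/
theorem weilPositivityOn_of_le_59_100 {A : ℝ} (hA : A ≤ 59 / 100) : WeilPositivityOn A :=
  fun g hg hs ↦ weilPositivityOn_59_100 g hg (hs.trans (Icc_subset_Icc (by linarith) hA))

/-- **F4-B⁻ unconditional** (window `log n₀/2 + b ≤ 59/100`): the down-cone tail bound with no
positivity hypothesis. [cite: Bombieri2000Weil, §4] -/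
theorem downCone_twin_le_59_100 {w' : ℕ → ℝ} {n₀ : ℕ} {b ε δ : ℝ} (hb : 0 < b)
    (hbL : 2 * b < Real.log n₀) (ha : Real.log n₀ / 2 + b ≤ 59 / 100)
    (hlow : ∀ n : ℕ, Real.log n ≤ 2 * b → w' n = zetaTable n)
    (hhigh : ∀ n : ℕ, 2 * b < Real.log n → Real.log n ≤ Real.log n₀ + 2 * b → w' n ≤ zetaTable n)
    (hδ : δ ≤ zetaTable n₀ - w' n₀)
    {g₁ : ℝ → ℝ} (h1 : (∀ t, 0 ≤ g₁ t) ∨ (∀ t, g₁ t ≤ 0))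
    (hg : IsWeilTest fun t ↦ (g₁ t : ℂ)) (hs : tsupport (fun t ↦ (g₁ t : ℂ)) ⊆ Icc (-b) b)
    (hq : (weilQuadratic fun t ↦ (g₁ t : ℂ)).re ≤ ε * ∫ x, ‖(g₁ x : ℂ)‖ ^ 2) :
    ((tableDatum w').quadratic (twin (Real.log n₀ / 2) 1 fun t ↦ (g₁ t : ℂ))).re ≤
      (2 * ε - δ) * (2 * ∫ x, ‖(g₁ x : ℂ)‖ ^ 2) :=
  downCone_twin_le hb hbL hlow hhigh hδ (weilPositivityOn_of_le_59_100 ha) h1 hg hs hq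

/-- **F4-B⁺ unconditional** (window `log n₀/2 + b ≤ 59/100`): the up-cone tail bound with no
positivity hypothesis; the direction `g₁(· + log n₀/2) + g₁(· - log n₀/2)` is one-signed.
[cite: Bombieri2000Weil, §4] -/
theorem upCone_twin_le_59_100 {w' : ℕ → ℝ} {n₀ : ℕ} {b ε δ : ℝ} (hb : 0 < b)
    (hbL : 2 * b < Real.log n₀) (ha : Real.log n₀ / 2 + b ≤ 59 / 100)
    (hup : ∀ n : ℕ, Real.log n ≤ Real.log n₀ + 2 * b → zetaTable n ≤ w' n)
    (hδ : δ ≤ w' n₀ - zetaTable n₀)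
    {g₁ : ℝ → ℝ} (h1 : (∀ t, 0 ≤ g₁ t) ∨ (∀ t, g₁ t ≤ 0))
    (hg : IsWeilTest fun t ↦ (g₁ t : ℂ)) (hs : tsupport (fun t ↦ (g₁ t : ℂ)) ⊆ Icc (-b) b)
    (hq : (weilQuadratic fun t ↦ (g₁ t : ℂ)).re ≤ ε * ∫ x, ‖(g₁ x : ℂ)‖ ^ 2) :
    ((tableDatum w').quadratic (twin (Real.log n₀ / 2) (-1) fun t ↦ (g₁ t : ℂ))).re ≤
      (2 * ε - δ) * (2 * ∫ x, ‖(g₁ x : ℂ)‖ ^ 2) :=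
  upCone_twin_le hb hbL hup hδ (weilPositivityOn_of_le_59_100 ha) h1 hg hs hq

/-- **Every sign twist with `f(2) = -1` is negative at the window `log 2/2 + b ≤ 59/100`,
unconditionally**, once the bump's Rayleigh number satisfies `ε < Λ(2)/√2 = w_ζ(2)` (`|f| ≤ 1`,
`f = 1` on `log n ≤ 2b`, i.e. on `n = 1` since `2b < log 2`). [cite: Bombieri2000Weil, §4] -/
theorem twist_two_twin_neg_59_100 {f : ℕ → ℝ} {b ε : ℝ} (hb : 0 < b) (hbL : 2 * b < Real.log 2)
    (ha : Real.log 2 / 2 + b ≤ 59 / 100) (hf1 : ∀ n, |f n| ≤ 1)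
    (hlow : ∀ n : ℕ, Real.log n ≤ 2 * b → f n = 1) (hf0 : f 2 = -1)
    {g₁ : ℝ → ℝ} (h1 : (∀ t, 0 ≤ g₁ t) ∨ (∀ t, g₁ t ≤ 0))
    (hg : IsWeilTest fun t ↦ (g₁ t : ℂ)) (hs : tsupport (fun t ↦ (g₁ t : ℂ)) ⊆ Icc (-b) b)
    (hq : (weilQuadratic fun t ↦ (g₁ t : ℂ)).re ≤ ε * ∫ x, ‖(g₁ x : ℂ)‖ ^ 2)
    (hpos : 0 < ∫ x, ‖(g₁ x : ℂ)‖ ^ 2) (hε : ε < zetaTable 2) :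
    ((tableDatum (twistTable f)).quadratic
        (twin (Real.log (2 : ℕ) / 2) 1 fun t ↦ (g₁ t : ℂ))).re < 0 := by
  have hbL' : 2 * b < Real.log (2 : ℕ) := by exact_mod_cast hbL
  have ha' : Real.log (2 : ℕ) / 2 + b ≤ 59 / 100 := by exact_mod_cast ha
  refine lt_of_le_of_lt (twist_twin_le hb hbL' hf1 hlow hf0 (weilPositivityOn_of_le_59_100 ha')
    h1 hg hs hq) (mul_neg_of_neg_of_pos (by linarith) (by linarith))

end Summit.RiemannHypothesis.RiemannHypothesis.Theorems.PfPersistenceConeTailBound59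

end
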